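import Summits.Ventures.PercRepro2.CaseOnePendantQ
import Summits.Ventures.PercRepro2.CaseOneJOneStar

/-!
# Pendant paths: the four case-1 forms propagate along a pendant path of any length
(blind cell PercRepro2, p1 g21; S5 §2.1 (K9): the pendant lemma K8 and its Q-side, iterated)

A vertex `v` closed on the four forms `(ii)`, `(ii-Q)`, `(i)`, `(i-Q)` passes all four to every leaf
hanging at it (K8: `zSplitII_of_leaf_at`, `zSplitI_of_leaf_at`; the Q-side: `zSplitIIQ_of_leaf_at`,
`zSplitIQ_of_leaf_at`), and the leaf is again such a vertex. `IsPendantPathAt P o a₁ a₂ b n E ends v a₃`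
says that `a₃` hangs at `v` by a pendant path of `n` edges avoiding the marks — `a₃` is a leaf at some `x`
through `e₀`, and in `G − e₀` the vertex `x` hangs at `v` by a path of `n − 1` edges — whose anchor `v`
satisfies the structural predicate `P` in the graph with the whole path deleted. **`fourForms_of_pendantPath`**:
if `P` forces the four forms at the anchor in every graph, then the end `a₃` of the path has the four forms
in `G` — by induction on the length, each step being the leaf-deletion transfer (`CaseOneLeafDelete`), K8
and the Q-side. Corollaries: `(J1₁)`, `(J1)` (with the mirrored anchor predicate) and `(RV)` at the end of
the path, and the instances at a marked-star anchor (`*_of_pendantPath_markedStar`) and a uwob-gadget anchor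
(`*_of_pendantPath_gadgetUWOB`; the root swap of the star `IsMarkedStarAt.swap` is `CaseOneJOneStar`'s): every row of the class table for every vertex at the end of a pendant
path of any length at such a vertex — the pendant classes of `CaseOneStarPendant` /
`CaseOneGadgetUWOBPendant` are the case `n = 1`, the closers themselves the case `n = 0`. Own code;
standard axioms. -/

namespace Summit.Ventures.PercRepro2

namespace CaseOne

universe u

section PathDef
variable {V : Type*}

/-- **A pendant path of `n` edges from the anchor `v` to `a₃`, avoiding the marks, whose anchor satisfies
`P` in the graph with the path deleted**: `n = 0` means `a₃ = v` and `P E ends v`; `n + 1` means `a₃` is a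
leaf at some `x` through `e₀`, `a₃ ∉ {o, a₁, a₂, b}`, and in `G − e₀` the vertex `x` hangs at `v` by a
pendant path of `n` edges. -/
def IsPendantPathAt (P : (E : Type u) → (E → Sym2 V) → V → Prop) (o a₁ a₂ b : V) :
    (n : ℕ) → (E : Type u) → [Fintype E] → [DecidableEq E] → (E → Sym2 V) → V → V → Prop
  | 0, E, _, _, ends, v, a₃ => a₃ = v ∧ P E ends v
  | n + 1, E, _, _, ends, v, a₃ => ∃ (x : V) (e₀ : E), IsLeafAt ends x a₃ e₀ ∧ o ≠ a₃ ∧ a₁ ≠ a₃ ∧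
      a₂ ≠ a₃ ∧ b ≠ a₃ ∧ IsPendantPathAt P o a₁ a₂ b n {e : E // e ≠ e₀} (restrictEnds ends e₀) v x

/-- The roots of the marks can be swapped in a pendant-path predicate. -/
theorem IsPendantPathAt.swap (P : (E : Type u) → (E → Sym2 V) → V → Prop) (o a₁ a₂ b : V) :
    ∀ (n : ℕ) (E : Type u) [Fintype E] [DecidableEq E] (ends : E → Sym2 V) (v a₃ : V),
      IsPendantPathAt P o a₁ a₂ b n E ends v a₃ → IsPendantPathAt P o a₂ a₁ b n E ends v a₃ := by
  intro n
  induction n with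
  | zero =>
    intro E _ _ ends v a₃ h
    exact h
  | succ n ih =>
    intro E _ _ ends v a₃ h
    obtain ⟨x, e₀, hl, ho, h1, h2, hb, hpath⟩ := h
    exact ⟨x, e₀, hl, ho, h2, h1, hb, ih _ _ v x hpath⟩

end PathDef

section FourForms
variable {V : Type*} {E : Type*} [Fintype E] [DecidableEq E] {R : Type*} [CommRing R] [LinearOrder R]

/-- The four case-1 forms at the statement vertex `v`: `(ii)`, `(ii-Q)`, `(i)`, `(i-Q)`. -/
def FourForms (p : E → R) (ends : E → Sym2 V) (o a₁ a₂ v b : V) : Prop :=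
  ZSplitII p ends o a₁ a₂ v b ∧ ZSplitIIQ p ends o a₁ a₂ v b ∧ ZSplitI p ends o a₁ a₂ v b ∧
    ZSplitIQ p ends o a₁ a₂ v b

end FourForms

section PathTheorem
variable {V : Type*} {R : Type*} [CommRing R] [LinearOrder R] [IsStrictOrderedRing R]

/-- **The four forms propagate along a pendant path of any length**: if the anchor predicate `P` forces
`(ii)`, `(ii-Q)`, `(i)`, `(i-Q)` at the anchor in every finite graph, then the end `a₃` of a pendant path of
`n` edges at such an anchor has the four forms in `G`, for every weight vector. -/
theorem fourForms_of_pendantPath (P : (E : Type u) → (E → Sym2 V) → V → Prop) (o a₁ a₂ b : V)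
    (hP : ∀ (E : Type u) [Fintype E] [DecidableEq E] (ends : E → Sym2 V) (p : E → R), IsProbVec p →
      ∀ v, P E ends v → FourForms p ends o a₁ a₂ v b) :
    ∀ (n : ℕ) (E : Type u) [Fintype E] [DecidableEq E] (ends : E → Sym2 V) (p : E → R), IsProbVec p →
      ∀ (v a₃ : V), IsPendantPathAt P o a₁ a₂ b n E ends v a₃ → FourForms p ends o a₁ a₂ a₃ b := by
  intro n
  induction n with
  | zero =>
    intro E _ _ ends p hp v a₃ h
    obtain ⟨rfl, hPv⟩ := h
    exact hP E ends p hp _ hPv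
  | succ n ih =>
    intro E _ _ ends p hp v a₃ h
    obtain ⟨x, e₀, hl, ho, h1, h2, hb, hpath⟩ := h
    have hx' : FourForms (restrictW p e₀) (restrictEnds ends e₀) o a₁ a₂ x b :=
      ih {e : E // e ≠ e₀} (restrictEnds ends e₀) (restrictW p e₀) (IsProbVec.restrictW hp e₀) v x hpath
    have hx : FourForms p ends o a₁ a₂ x b :=
      ⟨zSplitII_of_restrict p hl ho h1 h2 hl.ne hb hx'.1,
        zSplitIIQ_of_restrict p hl ho h1 h2 hl.ne hb hx'.2.1,
        zSplitI_of_restrict p hl ho h1 h2 hl.ne hb hx'.2.2.1,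
        zSplitIQ_of_restrict p hl ho h1 h2 hl.ne hb hx'.2.2.2⟩
    exact ⟨zSplitII_of_leaf_at p hp hl o a₁ a₂ b ho h1 h2 hb hx.1 hx.2.1,
      zSplitIIQ_of_leaf_at p hp hl o a₁ a₂ b ho h1 h2 hb hx.2.1,
      zSplitI_of_leaf_at p hp hl o a₁ a₂ b ho h1 h2 hb hx.2.2.1 hx.2.2.2,
      zSplitIQ_of_leaf_at p hp hl o a₁ a₂ b ho h1 h2 hb hx.2.2.2⟩

variable {E : Type u} [Fintype E] [DecidableEq E] {ends : E → Sym2 V} {o a₁ a₂ b v a₃ : V}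

/-- **`(J1₁)` at the end of a pendant path** at an anchor closed on the four forms. -/
theorem jOneOne_of_pendantPath (P : (E : Type u) → (E → Sym2 V) → V → Prop)
    (hP : ∀ (E : Type u) [Fintype E] [DecidableEq E] (ends : E → Sym2 V) (p : E → R), IsProbVec p →
      ∀ v, P E ends v → FourForms p ends o a₁ a₂ v b)
    {n : ℕ} (p : E → R) (hp : IsProbVec p) (h : IsPendantPathAt P o a₁ a₂ b n E ends v a₃) :
    JOneOne p ends o a₁ a₂ a₃ b :=
  let h4 := fourForms_of_pendantPath P o a₁ a₂ b hP n E ends p hp v a₃ h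
  jOneOne_of_i_of_ii p ends o a₁ a₂ a₃ b h4.2.2.1 h4.1

/-- **`(J1)` at the end of a pendant path** at an anchor closed on the four forms for both orders of the
roots. -/
theorem jOne_of_pendantPath (P : (E : Type u) → (E → Sym2 V) → V → Prop)
    (hP : ∀ (E : Type u) [Fintype E] [DecidableEq E] (ends : E → Sym2 V) (p : E → R), IsProbVec p →
      ∀ v, P E ends v → FourForms p ends o a₁ a₂ v b)
    (hP' : ∀ (E : Type u) [Fintype E] [DecidableEq E] (ends : E → Sym2 V) (p : E → R), IsProbVec p →
      ∀ v, P E ends v → FourForms p ends o a₂ a₁ v b)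
    {n : ℕ} (p : E → R) (hp : IsProbVec p) (h : IsPendantPathAt P o a₁ a₂ b n E ends v a₃) :
    JOne p ends o a₁ a₂ a₃ b :=
  jOne_of_jOneOne_of_mirror p ends o a₁ a₂ a₃ b (jOneOne_of_pendantPath P hP p hp h)
    (jOneOne_of_pendantPath P hP' p hp (IsPendantPathAt.swap P o a₁ a₂ b n E ends v a₃ h))

/-- **`(RV)` at the end of a pendant path** (when the required-vertex world has mass). -/
theorem rv_of_pendantPath (P : (E : Type u) → (E → Sym2 V) → V → Prop)
    (hP : ∀ (E : Type u) [Fintype E] [DecidableEq E] (ends : E → Sym2 V) (p : E → R), IsProbVec p →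
      ∀ v, P E ends v → FourForms p ends o a₁ a₂ v b)
    {n : ℕ} (p : E → R) (hp : IsProbVec p) (h : IsPendantPathAt P o a₁ a₂ b n E ends v a₃)
    (hT : 0 < prob p (Tp ends a₁ a₂ a₃)) : RV p ends o a₁ a₂ a₃ b :=
  (rv_iff_ii p ends o a₁ a₂ a₃ b hT).2 (fourForms_of_pendantPath P o a₁ a₂ b hP n E ends p hp v a₃ h).1

end PathTheorem

section AnchorDefs
variable {V : Type*}

/-- The marked-star anchor: `v` is adjacent exactly to `a₁, a₂, o, b`. -/
def MarkedStarAnchor (o a₁ a₂ b : V) (E : Type u) (ends : E → Sym2 V) (v : V) : Prop :=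
  ∃ e₁ e₂ eo eb : E, IsMarkedStarAt ends o a₁ a₂ b v e₁ e₂ eo eb

/-- The uwob-gadget anchor: `v ~ {w, o, b}` with `w ~ {v, a₁, a₂}` for some unmarked `w`. -/
def GadgetUWOBAnchor (o a₁ a₂ b : V) (E : Type u) (ends : E → Sym2 V) (v : V) : Prop :=
  ∃ (w : V) (euw euo eub ewa1 ewa2 : E), IsGadgetUWOB ends o a₁ a₂ b v w euw euo eub ewa1 ewa2

variable (o a₁ a₂ b : V)

/-- A marked-star anchor with the roots swapped is a marked-star anchor. -/
theorem MarkedStarAnchor.swap (E : Type u) (ends : E → Sym2 V) (v : V)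
    (h : MarkedStarAnchor o a₁ a₂ b E ends v) : MarkedStarAnchor o a₂ a₁ b E ends v := by
  obtain ⟨e₁, e₂, eo, eb, h⟩ := h
  exact ⟨e₂, e₁, eo, eb, h.swap⟩

/-- A uwob-gadget anchor with the roots swapped is a uwob-gadget anchor. -/
theorem GadgetUWOBAnchor.swap (E : Type u) (ends : E → Sym2 V) (v : V)
    (h : GadgetUWOBAnchor o a₁ a₂ b E ends v) : GadgetUWOBAnchor o a₂ a₁ b E ends v := by
  obtain ⟨w, euw, euo, eub, ewa1, ewa2, h⟩ := h
  exact ⟨w, euw, euo, eub, ewa2, ewa1, h.swap⟩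

end AnchorDefs

section Anchors
variable {V : Type*} [Fintype V] [DecidableEq V] {R : Type*} [Field R] [LinearOrder R]
  [IsStrictOrderedRing R]

variable (o a₁ a₂ b : V)

/-- A marked-star anchor has the four forms (`CaseOneStarMain`, `MainQt`, `MainI`, `MainQtI`). -/
theorem fourForms_of_markedStarAnchor (E : Type u) [Fintype E] [DecidableEq E] (ends : E → Sym2 V)
    (p : E → R) (hp : IsProbVec p) (v : V) (h : MarkedStarAnchor o a₁ a₂ b E ends v) :
    FourForms p ends o a₁ a₂ v b := by
  obtain ⟨e₁, e₂, eo, eb, h⟩ := h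
  exact ⟨zSplitII_of_markedStar p hp h, zSplitIIQ_of_markedStar p hp h, zSplitI_of_markedStar p hp h,
    zSplitIQ_of_markedStar p hp h⟩

/-- A uwob-gadget anchor has the four forms (`CaseOneGadgetUWOBMainII`, `MainQ`, `MainI`, `MainIQ`). -/
theorem fourForms_of_gadgetUWOBAnchor (E : Type u) [Fintype E] [DecidableEq E] (ends : E → Sym2 V)
    (p : E → R) (hp : IsProbVec p) (v : V) (h : GadgetUWOBAnchor o a₁ a₂ b E ends v) :
    FourForms p ends o a₁ a₂ v b := by
  obtain ⟨w, euw, euo, eub, ewa1, ewa2, h⟩ := h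
  exact ⟨zSplitII_of_gadgetUWOB p hp h, zSplitIIQ_of_gadgetUWOB p hp h, zSplitI_of_gadgetUWOB p hp h,
    zSplitIQ_of_gadgetUWOB p hp h⟩

variable {E : Type u} [Fintype E] [DecidableEq E] {ends : E → Sym2 V} {v a₃ : V} {n : ℕ}

/-- **The four forms at the end of a pendant path of any length at a marked-star vertex**, every finite
graph, every weight vector. -/
theorem fourForms_of_pendantPath_markedStar (p : E → R) (hp : IsProbVec p)
    (h : IsPendantPathAt (MarkedStarAnchor o a₁ a₂ b) o a₁ a₂ b n E ends v a₃) :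
    FourForms p ends o a₁ a₂ a₃ b :=
  fourForms_of_pendantPath (MarkedStarAnchor o a₁ a₂ b) o a₁ a₂ b
    (fourForms_of_markedStarAnchor o a₁ a₂ b) n E ends p hp v a₃ h

/-- **`(J1)` at the end of a pendant path of any length at a marked-star vertex.** -/
theorem jOne_of_pendantPath_markedStar (p : E → R) (hp : IsProbVec p)
    (h : IsPendantPathAt (MarkedStarAnchor o a₁ a₂ b) o a₁ a₂ b n E ends v a₃) :
    JOne p ends o a₁ a₂ a₃ b :=
  jOne_of_pendantPath (MarkedStarAnchor o a₁ a₂ b) (fourForms_of_markedStarAnchor o a₁ a₂ b)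
    (fun E' _ _ ends' p' hp' v' h' =>
      fourForms_of_markedStarAnchor o a₂ a₁ b E' ends' p' hp' v' (MarkedStarAnchor.swap o a₁ a₂ b E' ends' v' h'))
    p hp h

/-- **`(RV)` at the end of a pendant path of any length at a marked-star vertex.** -/
theorem rv_of_pendantPath_markedStar (p : E → R) (hp : IsProbVec p)
    (h : IsPendantPathAt (MarkedStarAnchor o a₁ a₂ b) o a₁ a₂ b n E ends v a₃)
    (hT : 0 < prob p (Tp ends a₁ a₂ a₃)) : RV p ends o a₁ a₂ a₃ b :=
  rv_of_pendantPath (MarkedStarAnchor o a₁ a₂ b) (fourForms_of_markedStarAnchor o a₁ a₂ b) p hp h hT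

/-- **The four forms at the end of a pendant path of any length at a uwob-gadget vertex**, every finite
graph, every weight vector. -/
theorem fourForms_of_pendantPath_gadgetUWOB (p : E → R) (hp : IsProbVec p)
    (h : IsPendantPathAt (GadgetUWOBAnchor o a₁ a₂ b) o a₁ a₂ b n E ends v a₃) :
    FourForms p ends o a₁ a₂ a₃ b :=
  fourForms_of_pendantPath (GadgetUWOBAnchor o a₁ a₂ b) o a₁ a₂ b
    (fourForms_of_gadgetUWOBAnchor o a₁ a₂ b) n E ends p hp v a₃ h

/-- **`(J1)` at the end of a pendant path of any length at a uwob-gadget vertex.** -/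
theorem jOne_of_pendantPath_gadgetUWOB (p : E → R) (hp : IsProbVec p)
    (h : IsPendantPathAt (GadgetUWOBAnchor o a₁ a₂ b) o a₁ a₂ b n E ends v a₃) :
    JOne p ends o a₁ a₂ a₃ b :=
  jOne_of_pendantPath (GadgetUWOBAnchor o a₁ a₂ b) (fourForms_of_gadgetUWOBAnchor o a₁ a₂ b)
    (fun E' _ _ ends' p' hp' v' h' =>
      fourForms_of_gadgetUWOBAnchor o a₂ a₁ b E' ends' p' hp' v' (GadgetUWOBAnchor.swap o a₁ a₂ b E' ends' v' h'))
    p hp h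

/-- **`(RV)` at the end of a pendant path of any length at a uwob-gadget vertex.** -/
theorem rv_of_pendantPath_gadgetUWOB (p : E → R) (hp : IsProbVec p)
    (h : IsPendantPathAt (GadgetUWOBAnchor o a₁ a₂ b) o a₁ a₂ b n E ends v a₃)
    (hT : 0 < prob p (Tp ends a₁ a₂ a₃)) : RV p ends o a₁ a₂ a₃ b :=
  rv_of_pendantPath (GadgetUWOBAnchor o a₁ a₂ b) (fourForms_of_gadgetUWOBAnchor o a₁ a₂ b) p hp h hT

end Anchors

end CaseOne

end Summit.Ventures.PercRepro2
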